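import Summits.PneNP.PneNP.Theorems.ConvexRankGatesConvexGateBlindExactLiftingCalibration

/-!
# Calibration of `ExactLifting` from the PSD side: sum-of-squares certificates lift to PSD factorisations

Support file for crux `ConvexGateBlind` (stmt-PneNP-10680), line `xor-door-perfect-completeness`, open stub
`stub_exactLifting` (lead c2, 2026-08-16).

`ExactLifting` (`Theorems/ConvexRankGatesConvexGateBlindXorDefs.lean`) asks for an unbounded `φ` with `q + r ≥ t^{φ(d)}`
for every `(PSD_q ⊕ ℝ^r_{≥0})`-factorisation of the shifted Index-lift `viol_F(x[w]) − ε` of every degree-`d` perfectly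
fooled unsatisfiable `F`. The sibling file `…ExactLiftingCalibration.lean` (lead c1) bounds `φ` through the `r`-part of
the cone: a positive degree-`k` Sherali–Adams value gives a NON-NEGATIVE factorisation with `O_F(t^k)` terms. This file is
the twin statement for the `q`-part:

* `sosLift_identity` — a function `s(y) = Σ_{(S,b)} c(S,b)·1[y|_S = b]` in the span of the `k`-junta indicators lifts
  through the Index gadget to a bilinear form: `s(x[w]) = ⟨Φ(x), Ψ(w)⟩` with `Ψ(w)_{(S,b,π)} = 1[w|_S = π]` and
  `Φ(x)_{(S,b,π)} = c(S,b)·1[x|_S ∘ π = b]`, over the index set of triples `(S, b, π)` (`#S ≤ k`).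
* `hasConeFact_shift_of_sosCert` — consequently a PURE SUM-OF-SQUARES certificate
  `viol_F(y) − ε = Σ_j s_j(y)²` with every `s_j` in the span of the `k`-junta indicators yields a PSD factorisation
  (`r = 0`) of the shifted lift, `viol_F(x[w]) − ε = tr(H_x Y_w)` with `H_x = Σ_j Φ_j(x)Φ_j(x)ᵀ ⪰ 0` and
  `Y_w = Ψ(w)Ψ(w)ᵀ ⪰ 0` of dimension `q ≤ #{S : #S ≤ k} · (2t)^k`.
* `exactLifting_exponent_le_sos`, `exactLifting_sos_calibration` — hence any exponent function `φ` as in `ExactLifting`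
  satisfies `φ(d) ≤ k` as soon as SOME degree-`d` perfectly fooled unsatisfiable `F` admits such a certificate of
  square-degree `k` for some `ε > 0`.

Why this sharpens the calibration. On XOR ground a tree-like Gaussian refutation of width `w` (every derived parity and
every pair of premises supported on `≤ w` variables) with leaf multiplicities `≤ N` gives the pure SOS certificate
`viol_F − 1/N = (1/N)·(Σ_steps 2 (V_A V_B)² + Σ_C (N − n_C) V_C²)` (`V_A = (1 − σ_A χ_A)/2` the violation indicator of a
parity line; `V_A + V_B − V_{AΔB} = 2 V_A V_B = 2 (V_A V_B)²` on the cube), whose squares have junta-degree `≤ w`; so the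
`q`-part of the cone pays `t^{width}` where the `r`-part pays `t^{static SA degree}`. Example: the odd-charge Tseitin
system on `K₄` (six edge variables, four vertex equations) is degree-`3` perfectly fooled, its static Sherali–Adams
degree is exactly `5`, but `viol − 1 = 2(V₁V₂)² + 2(V₁₂V₃)²` with both squares in the span of `4`-junta indicators, so
its mixed-cone exponent is at most `4`: on this instance the PSD part is strictly cheaper than any non-negative
factorisation through juntas. (The K₄ identity is recorded here as prose; the general statement below is what the stub's
calibration needs.)
-/

set_option linter.dupNamespace false -- `Summit.PneNP.PneNP.…`: summit = sub-problem (D-0017)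

namespace Summit.PneNP.PneNP.Theorems.XorDoor

open scoped BigOperators Classical
open Finset Matrix

noncomputable section

/-! ## §1 Lifting a junta-span function through the Index gadget -/

/-
Index conventions (kept inline, no new definitions): a junta indicator of order `≤ k` is a pair `(S, b)` with
`#S ≤ k`, `b : S → 𝔽₂`; a lifted coordinate is a triple `(S, b, π)` with `π : S → Fin t` a pointer pattern.
-/

/-- The number of lifted coordinates `(S, b, π)` is at most `#{S : #S ≤ k} · (2t)^k` (for `t ≥ 1`). -/
theorem card_liftIdx_le (m k t : ℕ) (ht : 1 ≤ t) :
    Fintype.card (Σ S : {S : Finset (Fin m) // S.card ≤ k}, ({i // i ∈ S.1} → ZMod 2) × ({i // i ∈ S.1} → Fin t)) ≤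
      Fintype.card {S : Finset (Fin m) // S.card ≤ k} * (2 * t) ^ k := by
  rw [Fintype.card_sigma]
  have hfib : ∀ S : {S : Finset (Fin m) // S.card ≤ k},
      Fintype.card (({i // i ∈ S.1} → ZMod 2) × ({i // i ∈ S.1} → Fin t)) ≤ (2 * t) ^ k := by
    intro S
    rw [Fintype.card_prod, Fintype.card_fun, Fintype.card_fun, ZMod.card, Fintype.card_fin,
      Fintype.card_coe, ← mul_pow]
    exact Nat.pow_le_pow_right (by omega) S.2
  calc ∑ S, Fintype.card (({i // i ∈ S.1} → ZMod 2) × ({i // i ∈ S.1} → Fin t))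
      ≤ ∑ _S : {S : Finset (Fin m) // S.card ≤ k}, (2 * t) ^ k := Finset.sum_le_sum fun S _ => hfib S
    _ = Fintype.card {S : Finset (Fin m) // S.card ≤ k} * (2 * t) ^ k := by
        rw [Finset.sum_const, Finset.card_univ, smul_eq_mul]

/-- **Lifting identity.** For `s(y) = Σ_{(S,b)} c(S,b)·1[y|_S = b]`:  `s(x[w]) = Σ_{(S,b,π)} Φ(x)_{(S,b,π)} Ψ(w)_{(S,b,π)}`
with the table-side vector `Φ(x)_{(S,b,π)} = c(S,b)·1[x|_S ∘ π = b]` and the pointer-side vector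
`Ψ(w)_{(S,b,π)} = 1[w|_S = π]` (for each `(S, b)` exactly one pointer pattern, `π = w|_S`, contributes). -/
theorem sosLift_identity {m k t : ℕ} (c : (Σ S : {S : Finset (Fin m) // S.card ≤ k}, ({i // i ∈ S.1} → ZMod 2)) → ℝ)
    (x : Fin m → Fin t → ZMod 2) (w : Fin m → Fin t) :
    ∑ g : (Σ S : {S : Finset (Fin m) // S.card ≤ k}, ({i // i ∈ S.1} → ZMod 2) × ({i // i ∈ S.1} → Fin t)),
        (c ⟨g.1, g.2.1⟩ * (if (∀ i : {i // i ∈ g.1.1}, x i.1 (g.2.2 i) = g.2.1 i) then (1 : ℝ) else 0)) *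
          (if (∀ i : {i // i ∈ g.1.1}, w i.1 = g.2.2 i) then (1 : ℝ) else 0) =
      ∑ g : (Σ S : {S : Finset (Fin m) // S.card ≤ k}, ({i // i ∈ S.1} → ZMod 2)),
        c g * (if (∀ i : {i // i ∈ g.1.1}, x i.1 (w i.1) = g.2 i) then (1 : ℝ) else 0) := by
  rw [Fintype.sum_sigma, Fintype.sum_sigma]
  refine Finset.sum_congr rfl fun S _ => ?_
  rw [Fintype.sum_prod_type]
  refine Finset.sum_congr rfl fun b _ => ?_
  rw [Finset.sum_eq_single (fun i : {i // i ∈ S.1} => w i.1)]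
  · simp
  · intro π _ hπ
    have : ¬ ∀ i : {i // i ∈ S.1}, w i.1 = π i := fun hall => hπ (funext fun i => (hall i).symm)
    simp only [this, if_false, mul_zero]
  · intro h; exact absurd (Finset.mem_univ _) h

/-! ## §2 A pure SOS certificate lifts to a PSD factorisation -/

/-- `tr (vecMulVec a a * vecMulVec u u) = (a ⬝ᵥ u)²`. -/
theorem trace_vecMulVec_mul_vecMulVec {n : Type} [Fintype n] (a u : n → ℝ) :
    (vecMulVec a a * vecMulVec u u).trace = (a ⬝ᵥ u) ^ 2 := by
  rw [mul_vecMulVec, vecMulVec_mulVec, trace_vecMulVec, op_smul_eq_smul, smul_dotProduct, smul_eq_mul, sq]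

/-- **SOS certificates lift to PSD factorisations.** If `viol_F − ε = Σ_j s_j²` pointwise on `𝔽₂^m` with every `s_j`
a combination of junta indicators of order `≤ k` (coefficients `c j`), then for every `t ≥ 1` the shifted Index-lift
`viol_F(x[w]) − ε` has a `(PSD_q ⊕ ℝ^0)`-factorisation with `q ≤ #{S : #S ≤ k} · (2t)^k`:
`H_x = Σ_j Φ_j(x) Φ_j(x)ᵀ`, `Y_w = Ψ(w) Ψ(w)ᵀ`. -/
theorem hasConeFact_shift_of_sosCert {m k t : ℕ} (ht : 1 ≤ t) (F : Finset (Pool m)) {ε : ℝ}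
    {J : Type} [Fintype J] (c : J → (Σ S : {S : Finset (Fin m) // S.card ≤ k}, ({i // i ∈ S.1} → ZMod 2)) → ℝ)
    (hcert : ∀ y : Fin m → ZMod 2, (viol F y : ℝ) - ε =
      ∑ j, (∑ g : (Σ S : {S : Finset (Fin m) // S.card ≤ k}, ({i // i ∈ S.1} → ZMod 2)),
        c j g * (if (∀ i : {i // i ∈ g.1.1}, y i.1 = g.2 i) then (1 : ℝ) else 0)) ^ 2) :
    ∃ q : ℕ, q ≤ Fintype.card {S : Finset (Fin m) // S.card ≤ k} * (2 * t) ^ k ∧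
      HasConeFact (fun (x : Fin m → Fin t → ZMod 2) (w : Fin m → Fin t) =>
        (viol F (fun i => x i (w i)) : ℝ) - ε) q 0 := by
  -- lifted index set, its size, and an enumeration
  let L : Type := (Σ S : {S : Finset (Fin m) // S.card ≤ k}, ({i // i ∈ S.1} → ZMod 2) × ({i // i ∈ S.1} → Fin t))
  let q : ℕ := Fintype.card L
  let eL : L ≃ Fin q := Fintype.equivFin L
  -- the table-side vectors `Φ_j(x)` and the pointer-side vector `Ψ(w)`
  let Φ : J → (Fin m → Fin t → ZMod 2) → L → ℝ := fun j x g =>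
    c j ⟨g.1, g.2.1⟩ * (if (∀ i : {i // i ∈ g.1.1}, x i.1 (g.2.2 i) = g.2.1 i) then (1 : ℝ) else 0)
  let Ψ : (Fin m → Fin t) → L → ℝ := fun w g => if (∀ i : {i // i ∈ g.1.1}, w i.1 = g.2.2 i) then (1 : ℝ) else 0
  -- factors, transported to `Fin q`
  let a : J → (Fin m → Fin t → ZMod 2) → Fin q → ℝ := fun j x l => Φ j x (eL.symm l)
  let u : (Fin m → Fin t) → Fin q → ℝ := fun w l => Ψ w (eL.symm l)
  let H : (Fin m → Fin t → ZMod 2) → Matrix (Fin q) (Fin q) ℝ := fun x => ∑ j, vecMulVec (a j x) (a j x)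
  let Y : (Fin m → Fin t) → Matrix (Fin q) (Fin q) ℝ := fun w => vecMulVec (u w) (u w)
  have hdot : ∀ j x w, a j x ⬝ᵥ u w = ∑ g : (Σ S : {S : Finset (Fin m) // S.card ≤ k}, ({i // i ∈ S.1} → ZMod 2)),
      c j g * (if (∀ i : {i // i ∈ g.1.1}, x i.1 (w i.1) = g.2 i) then (1 : ℝ) else 0) := by
    intro j x w
    rw [← sosLift_identity (c j) x w, dotProduct, ← eL.symm.sum_comp (fun g => Φ j x g * Ψ w g)]
  refine ⟨q, card_liftIdx_le m k t ht, H, Y, (fun _ => Fin.elim0), (fun l => Fin.elim0 l), fun x => ?_, fun w => ?_,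
    fun _ l => Fin.elim0 l, fun l => Fin.elim0 l, fun x w => ?_⟩
  · exact posSemidef_sum _ fun j _ => by simpa using posSemidef_vecMulVec_self_star (a j x)
  · simpa using posSemidef_vecMulVec_self_star (u w)
  · rw [Finset.univ_eq_empty (α := Fin 0), Finset.sum_empty, add_zero]
    show (viol F (fun i => x i (w i)) : ℝ) - ε = ((∑ j, vecMulVec (a j x) (a j x)) * vecMulVec (u w) (u w)).trace
    rw [hcert, Finset.sum_mul, trace_sum]
    refine Finset.sum_congr rfl fun j _ => ?_
    rw [trace_vecMulVec_mul_vecMulVec, hdot]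

/-! ## §3 The SOS calibration of `ExactLifting` -/

/-- **SOS calibration.** Let `φ` be an exponent function as in `ExactLifting`. If some degree-`d` perfectly fooled
unsatisfiable `F` admits a pure sum-of-squares certificate `viol_F − ε = Σ_j s_j²` (`ε > 0`) with every `s_j` in the
span of the junta indicators of order `≤ k`, then `φ(d) ≤ k`: size-from-degree can never beat the square-degree of the
easiest degree-`d`-fooled system (on XOR ground: its Gaussian width). -/
theorem exactLifting_exponent_le_sos (φ : ℕ → ℕ)
    (hφ : ∀ (m d : ℕ) (F : Finset (Pool m)),
      (¬ ∃ y : Fin m → ZMod 2, ∀ e ∈ F, Sat y e) → HasPerfectPseudoExp d F →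
      ∃ T : ℕ, ∀ (t : ℕ) (ε : ℝ), T ≤ t → 0 < ε → ∀ q r : ℕ,
        HasConeFact (fun (x : Fin m → Fin t → ZMod 2) (w : Fin m → Fin t) =>
          (viol F (fun i => x i (w i)) : ℝ) - ε) q r →
        t ^ φ d ≤ q + r)
    {m d k : ℕ} (F : Finset (Pool m)) (hunsat : ¬ ∃ y : Fin m → ZMod 2, ∀ e ∈ F, Sat y e)
    (hE : HasPerfectPseudoExp d F) {ε : ℝ} (hε : 0 < ε)
    {J : Type} [Fintype J] (c : J → (Σ S : {S : Finset (Fin m) // S.card ≤ k}, ({i // i ∈ S.1} → ZMod 2)) → ℝ)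
    (hcert : ∀ y : Fin m → ZMod 2, (viol F y : ℝ) - ε =
      ∑ j, (∑ g : (Σ S : {S : Finset (Fin m) // S.card ≤ k}, ({i // i ∈ S.1} → ZMod 2)),
        c j g * (if (∀ i : {i // i ∈ g.1.1}, y i.1 = g.2 i) then (1 : ℝ) else 0)) ^ 2) :
    φ d ≤ k := by
  obtain ⟨T, hT⟩ := hφ m d F hunsat hE
  refine exponent_le_of_pow_le (C := Fintype.card {S : Finset (Fin m) // S.card ≤ k} * 2 ^ k)
    (T := max T 1) fun t ht => ?_
  have hT' : T ≤ t := le_trans (le_max_left _ _) ht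
  have ht1 : 1 ≤ t := le_trans (le_max_right _ _) ht
  obtain ⟨q, hq, hfact⟩ := hasConeFact_shift_of_sosCert ht1 F c hcert
  have h := hT t ε hT' hε q 0 hfact
  calc t ^ φ d ≤ q + 0 := h
    _ ≤ Fintype.card {S : Finset (Fin m) // S.card ≤ k} * (2 * t) ^ k := by rw [add_zero]; exact hq
    _ = Fintype.card {S : Finset (Fin m) // S.card ≤ k} * 2 ^ k * t ^ k := by rw [mul_pow]; ring

/-- **SOS calibration, packaged against the stub.** `ExactLifting` implies: for every `d, k`, if some degree-`d`
perfectly fooled unsatisfiable system has a pure SOS certificate of square-degree `k` for some `ε > 0`, then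
`φ(d) ≤ k` for the stub's exponent function `φ`. -/
theorem exactLifting_sos_calibration : ExactLifting →
    ∃ φ : ℕ → ℕ, (∀ K : ℕ, ∃ d : ℕ, K ≤ φ d) ∧
      ∀ (m d k : ℕ) (F : Finset (Pool m)),
        (¬ ∃ y : Fin m → ZMod 2, ∀ e ∈ F, Sat y e) → HasPerfectPseudoExp d F →
        (∃ (ε : ℝ) (n : ℕ) (c : Fin n → (Σ S : {S : Finset (Fin m) // S.card ≤ k}, ({i // i ∈ S.1} → ZMod 2)) → ℝ), 0 < ε ∧
          ∀ y : Fin m → ZMod 2, (viol F y : ℝ) - ε =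
            ∑ j, (∑ g : (Σ S : {S : Finset (Fin m) // S.card ≤ k}, ({i // i ∈ S.1} → ZMod 2)),
              c j g * (if (∀ i : {i // i ∈ g.1.1}, y i.1 = g.2 i) then (1 : ℝ) else 0)) ^ 2) →
        (∀ (m' d' : ℕ) (F' : Finset (Pool m')),
          (¬ ∃ y : Fin m' → ZMod 2, ∀ e ∈ F', Sat y e) → HasPerfectPseudoExp d' F' →
          ∃ T : ℕ, ∀ (t : ℕ) (ε : ℝ), T ≤ t → 0 < ε → ∀ q r : ℕ,
            HasConeFact (fun (x : Fin m' → Fin t → ZMod 2) (w : Fin m' → Fin t) =>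
              (viol F' (fun i => x i (w i)) : ℝ) - ε) q r → t ^ φ d' ≤ q + r) ∧
        φ d ≤ k := by
  rintro ⟨φ, hφu, hφ⟩
  refine ⟨φ, hφu, fun m d k F hunsat hE ⟨ε, n, c, hε, hcert⟩ => ⟨hφ, ?_⟩⟩
  exact exactLifting_exponent_le_sos φ hφ F hunsat hE hε c hcert

end

end Summit.PneNP.PneNP.Theorems.XorDoor
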